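import Mathlib
import Literature.NumberTheory.Transcendental.AssociatorsBar
import HarnessLib

/-!
# Integrability of the two-variable polylogarithm bar elements (Furusho 2011, §3)

Sibling file of `Associators.lean` (Part B.4 of the proof of `furusho_pentagon_doubleShuffle`
[Furusho2011, Thm 1.2]); everything is proved, no named facts.

An element `Σ c_I [ω_{i_m}|⋯|ω_{i_1}]` of `T(H¹_DR(M_{0,5}))` lies in Brown's `V(M_{0,5})` (is a
functional on `U𝔓₅`) iff it satisfies Chen's **integrability condition**
`Σ_I c_I [⋯|ω_{i_{j+1}} ∧ ω_{i_j}|⋯] = 0` at every position [Furusho2011, §3, (integrability)].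
Dually (Koszul duality between `H^*(M_{0,5})` and `U𝔓₅`), a functional on words in the five forms
`α₀, α₁, β₀, β₁, γ` is integrable iff it kills, at every position, the six quadratic relations of
`U𝔓₅` written in the basis `(P', Q', R', S', T') = (X₁₂, -X₂₃, X₄₅, -X₃₄, -X₂₄)` dual to the five forms
(from `Ω₅ = X₁₂ dx/x + X₂₃ d log(1-x) + X₄₅ dy/y + X₃₄ d log(1-y) + X₂₄ d log(1-xy)`,
[Furusho2011, §3]): `[P',S'], [P',R'], [Q',R'], [Q',T'] + [Q',S'], [S',Q'] + [S',T'],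
[Q',S'] - [R',T'] - [T',P']` (`BarFun.rel`; they are the relations `[X_{ij}, X_{kl}] = 0` of `𝔓₅`
transported to this basis, and pair to zero with the four relations `α₀∧α₁ = β₀∧β₁ = 0`,
`(α₀+β₀)∧γ = 0`, `α₁∧γ - β₁∧γ - α₁∧β₁ + α₀∧γ = 0` of `H²(M_{0,5})`).

* `BarFun.KillsTop ρ L`, `BarFun.Integrable L` — the integrability condition (at the top, and at
  every position).
* `BarFun.integrable_ly`, `BarFun.integrable_lxyD`, **`BarFun.integrable_lxy`** — the bar elements
  `l^y_t, l^{xy}_u, l^{x,y}_{s,t}` are integrable [Furusho2011, §3: "It is easy to see that they indeed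
  lie on V(M_{0,5}) … by induction on weights … d ∘ d Li_{𝐚,𝐛}(x,y) = 0"]. Furusho's argument is
  analytic; here the top condition is checked from the differential recursion applied twice
  (the six relations reduce to equalities of mixed second components), and the deeper positions
  follow by induction on the weight.
* `BarFun.integrable_swapL` — the relation set is symmetric under `x ↔ y`, so `l^{y,x}` is
  integrable too.

## References

* H. Furusho, *Double shuffle relation for associators*, Ann. of Math. 174 (2011), §3
  (V(M_{0,5}), integrability, Ω₅, the bar elements). [Furusho2011]
-/

namespace Literature.NumberTheory.Transcendental

namespace BarFun

open F5

/-! ## B.4.1 The six quadratic relations of `U𝔓₅` in the basis dual to the five forms -/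

/-- The commutator `[p, q]` as a coefficient function on ordered pairs of letters. [folklore] -/
def comm (p q : F5) : F5 → F5 → ℤ := fun x y =>
  (if x = p ∧ y = q then 1 else 0) - (if x = q ∧ y = p then 1 else 0)

/-- The six quadratic relations of `U𝔓₅` in the basis `(P',Q',R',S',T')` dual to
`(α₀,α₁,β₀,β₁,γ)`: `[P',S'], [P',R'], [Q',R'], [Q',T']+[Q',S'], [S',Q']+[S',T'],
[Q',S']-[R',T']-[T',P']` (the relations `[X_{ij},X_{kl}] = 0`, `{i,j} ∩ {k,l} = ∅`, of the pure sphere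
braid Lie algebra `𝔓₅` [Furusho2011, §2], transported along `X₁₃ = X₄₅ - X₁₂ - X₂₃`,
`X₅₁ = X₂₃ + X₂₄ + X₃₄`, …). [cite: Furusho2011, §2–§3] -/
def rel : Fin 6 → F5 → F5 → ℤ
  | 0 => comm a0 b1
  | 1 => comm a0 b0
  | 2 => comm a1 b0
  | 3 => comm a1 g + comm a1 b1
  | 4 => comm b1 a1 + comm b1 g
  | 5 => comm a1 b1 - comm b0 g - comm g a0

/-- A functional **kills the relation `ρ` at the top**: `Σ_{p,q} ρ(p,q) L(p q w) = 0` for all `w`,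
i.e. `Σ ρ(p,q) ∂_q ∂_p L = 0`. [cite: Furusho2011, §3 (integrability)] -/
def KillsTop (ρ : F5 → F5 → ℤ) (L : BarFun) : Prop := ∑ p : F5, ∑ q : F5, ρ p q • der q (der p L) = 0

/-- Shifting a functional by a prefix: `shift u L w = L (u w)`. [folklore] -/
def shift (u : List F5) (L : BarFun) : BarFun := fun w => L (u ++ w)

/-- `shift [] L = L`. [folklore] -/
@[simp] theorem shift_nil (L : BarFun) : shift [] L = L := rfl

/-- `shift (f u) L = shift u (∂_f L)`. [folklore] -/
theorem shift_cons (f : F5) (u : List F5) (L : BarFun) : shift (f :: u) L = shift u (der f L) := rfl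

/-- **Integrability** (membership in `V(M_{0,5})`): the functional kills the six relations of `U𝔓₅`
at every position. [cite: Furusho2011, §3 (integrability)] -/
def Integrable (L : BarFun) : Prop := ∀ (u : List F5) (i : Fin 6), KillsTop (rel i) (shift u L)

/-- Integrability, recursively: the top conditions, and integrability of all components.
[folklore] -/
theorem integrable_iff (L : BarFun) :
    Integrable L ↔ (∀ i, KillsTop (rel i) L) ∧ ∀ f, Integrable (der f L) := by
  constructor
  · intro h
    exact ⟨fun i => h [] i, fun f u i => h (f :: u) i⟩
  · rintro ⟨h0, h1⟩ u i
    cases u with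
    | nil => exact h0 i
    | cons f u => exact h1 f u i

/-! ### Linearity -/

/-- `0` kills every relation at the top. [folklore] -/
theorem killsTop_zero (ρ : F5 → F5 → ℤ) : KillsTop ρ 0 := by
  simp [KillsTop]

/-- `KillsTop ρ` is closed under addition. [folklore] -/
theorem KillsTop.add {ρ : F5 → F5 → ℤ} {L L' : BarFun} (h : KillsTop ρ L) (h' : KillsTop ρ L') :
    KillsTop ρ (L + L') := by
  unfold KillsTop at *
  simp only [der_add, smul_add, Finset.sum_add_distrib, h, h', add_zero]

/-- `KillsTop ρ` is closed under negation. [folklore] -/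
theorem KillsTop.neg {ρ : F5 → F5 → ℤ} {L : BarFun} (h : KillsTop ρ L) : KillsTop ρ (-L) := by
  unfold KillsTop at *
  simp only [der_neg, smul_neg, Finset.sum_neg_distrib, h, neg_zero]

/-- `KillsTop ρ` is closed under subtraction. [folklore] -/
theorem KillsTop.sub {ρ : F5 → F5 → ℤ} {L L' : BarFun} (h : KillsTop ρ L) (h' : KillsTop ρ L') :
    KillsTop ρ (L - L') := by
  rw [sub_eq_add_neg]; exact h.add h'.neg

/-- `0` is integrable. [folklore] -/
theorem integrable_zero : Integrable 0 := fun u i => by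
  have : shift u (0 : BarFun) = 0 := rfl
  rw [this]; exact killsTop_zero _

/-- Integrable functionals are closed under addition. [folklore] -/
theorem Integrable.add {L L' : BarFun} (h : Integrable L) (h' : Integrable L') : Integrable (L + L') :=
  fun u i => (h u i).add (h' u i)

/-- Integrable functionals are closed under negation. [folklore] -/
theorem Integrable.neg {L : BarFun} (h : Integrable L) : Integrable (-L) := fun u i => (h u i).neg

/-- Integrable functionals are closed under subtraction. [folklore] -/
theorem Integrable.sub {L L' : BarFun} (h : Integrable L) (h' : Integrable L') : Integrable (L - L') := by
  rw [sub_eq_add_neg]; exact h.add h'.neg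

/-- Integrable functionals are closed under list sums. [folklore] -/
theorem integrable_list_sum {ι : Type*} (l : List ι) (G : ι → BarFun) (h : ∀ i ∈ l, Integrable (G i)) :
    Integrable (l.map G).sum := by
  induction l with
  | nil => exact integrable_zero
  | cons i l ih =>
    rw [List.map_cons, List.sum_cons]
    exact (h i (by simp)).add (ih fun j hj => h j (by simp [hj]))

/-- Components of integrable functionals are integrable. [folklore] -/
theorem Integrable.der {L : BarFun} (h : Integrable L) (f : F5) : Integrable (der f L) :=
  ((integrable_iff L).mp h).2 f

/-- The unit `[]` is integrable. [folklore] -/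
theorem integrable_unit : Integrable unit := by
  intro u i
  cases u with
  | nil => cases i using Fin.cases <;> simp [KillsTop, rel, comm]
  | cons f u =>
    rw [shift_cons, der_unit]
    exact integrable_zero u i

/-! ### The top conditions spelled out -/

/-- Expanding a `KillsTop` condition over the 25 pairs. [folklore] -/
theorem killsTop_iff (ρ : F5 → F5 → ℤ) (L : BarFun) :
    KillsTop ρ L ↔ ∑ p : F5, ∑ q : F5, ρ p q • der q (der p L) = 0 := Iff.rfl


/-- The top evaluation `Σ_{p,q} ρ(p,q) ∂_q ∂_p L` as a function of the relation. [folklore] -/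
def topEval (ρ : F5 → F5 → ℤ) (L : BarFun) : BarFun := ∑ p : F5, ∑ q : F5, ρ p q • der q (der p L)

/-- `KillsTop ρ L ↔ topEval ρ L = 0`. [folklore] -/
theorem killsTop_iff_topEval (ρ : F5 → F5 → ℤ) (L : BarFun) : KillsTop ρ L ↔ topEval ρ L = 0 := Iff.rfl

/-- `topEval` is additive in the relation. [folklore] -/
theorem topEval_add (ρ ρ' : F5 → F5 → ℤ) (L : BarFun) :
    topEval (ρ + ρ') L = topEval ρ L + topEval ρ' L := by
  simp [topEval, add_smul, Finset.sum_add_distrib]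

/-- `topEval` respects subtraction of relations. [folklore] -/
theorem topEval_sub (ρ ρ' : F5 → F5 → ℤ) (L : BarFun) :
    topEval (ρ - ρ') L = topEval ρ L - topEval ρ' L := by
  simp [topEval, sub_smul, Finset.sum_sub_distrib]

/-- An enumeration of the five letters. [folklore] -/
def _root_.Literature.NumberTheory.Transcendental.F5.equivFin5 : F5 ≃ Fin 5 where
  toFun f := match f with | a0 => 0 | a1 => 1 | b0 => 2 | b1 => 3 | g => 4
  invFun i := match i with | 0 => a0 | 1 => a1 | 2 => b0 | 3 => b1 | 4 => g
  left_inv f := by cases f <;> rfl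
  right_inv i := by fin_cases i <;> rfl

/-- Sums over the five letters. [folklore] -/
theorem sum_F5 {M : Type*} [AddCommMonoid M] (G : F5 → M) :
    ∑ f : F5, G f = G a0 + G a1 + G b0 + G b1 + G g := by
  rw [← Fintype.sum_equiv F5.equivFin5.symm (G ∘ F5.equivFin5.symm) G fun i => rfl, Fin.sum_univ_five]
  rfl

/-- `topEval [p, q] L = ∂_q ∂_p L - ∂_p ∂_q L`. [folklore] -/
theorem topEval_comm (p q : F5) (L : BarFun) : topEval (comm p q) L = der q (der p L) - der p (der q L) := by
  unfold topEval comm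
  simp only [sub_smul, Finset.sum_sub_distrib, ite_smul, one_smul, zero_smul]
  congr 1 <;>
  · rw [sum_F5]; simp only [sum_F5]
    cases p <;> cases q <;> simp

/-- The six top conditions as equations between mixed second components. [folklore] -/
theorem killsTop_rel_iff (L : BarFun) (i : Fin 6) : KillsTop (rel i) L ↔
    (match i with
     | 0 => der b1 (der a0 L) - der a0 (der b1 L) = 0
     | 1 => der b0 (der a0 L) - der a0 (der b0 L) = 0
     | 2 => der b0 (der a1 L) - der a1 (der b0 L) = 0
     | 3 => der g (der a1 L) - der a1 (der g L) + (der b1 (der a1 L) - der a1 (der b1 L)) = 0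
     | 4 => der a1 (der b1 L) - der b1 (der a1 L) + (der g (der b1 L) - der b1 (der g L)) = 0
     | 5 => der b1 (der a1 L) - der a1 (der b1 L) - (der g (der b0 L) - der b0 (der g L)) -
         (der a0 (der g L) - der g (der a0 L)) = 0) := by
  rw [killsTop_iff_topEval]
  fin_cases i <;> simp only [rel, topEval_add, topEval_sub, topEval_comm]

/-! ## B.4.2 Integrability of `l^y` and `l^{xy}` -/

/-- `l^y` has only `β`-components. [folklore] -/
theorem der_ly_eq_zero {f : F5} (hf : f ≠ b0 ∧ f ≠ b1) : ∀ t : List ℕ, der f (ly t) = 0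
  | [] => by rw [ly_nil, der_unit]
  | 0 :: _ => by rw [ly_zero, der_zero]
  | 1 :: t' => by rw [der_ly_one, if_neg hf.2]
  | (d + 2) :: t' => by rw [der_ly_two, if_neg hf.1]

/-- The `β`-components of `l^y` are `0` or again some `l^y` of smaller size. [folklore] -/
theorem der_ly_cases (f : F5) : ∀ t : List ℕ,
    der f (ly t) = 0 ∨ ∃ t', der f (ly t) = ly t' ∧ t'.sum + t'.length < t.sum + t.length
  | [] => Or.inl (by rw [ly_nil, der_unit])
  | 0 :: _ => Or.inl (by rw [ly_zero, der_zero])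
  | 1 :: t' => by
    rw [der_ly_one]
    split_ifs
    · exact Or.inr ⟨t', rfl, by simp; omega⟩
    · exact Or.inl rfl
  | (d + 2) :: t' => by
    rw [der_ly_two]
    split_ifs
    · exact Or.inr ⟨(d + 1) :: t', rfl, by simp⟩
    · exact Or.inl rfl

/-- The top conditions for `l^y_t` (no relation involves two `β`-letters only). [folklore] -/
theorem killsTop_ly (t : List ℕ) (i : Fin 6) : KillsTop (rel i) (ly t) := by
  rw [killsTop_rel_iff]
  have h0 := der_ly_eq_zero (f := a0) (by decide) t
  have h1 := der_ly_eq_zero (f := a1) (by decide) t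
  have hg := der_ly_eq_zero (f := g) (by decide) t
  have hb0 : ∀ f, f ≠ b0 ∧ f ≠ b1 → der f (der b0 (ly t)) = 0 := fun f hf => by
    rcases der_ly_cases b0 t with h | ⟨t'', h, -⟩ <;> rw [h]
    · rfl
    · exact der_ly_eq_zero hf t''
  have hb1 : ∀ f, f ≠ b0 ∧ f ≠ b1 → der f (der b1 (ly t)) = 0 := fun f hf => by
    rcases der_ly_cases b1 t with h | ⟨t'', h, -⟩ <;> rw [h]
    · rfl
    · exact der_ly_eq_zero hf t''
  fin_cases i <;>
    simp [h0, h1, hg, hb0 a0 (by decide), hb0 a1 (by decide), hb0 g (by decide),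
      hb1 a0 (by decide), hb1 a1 (by decide), hb1 g (by decide)]

/-- **`l^y_t` is integrable** (it only involves `dy/y, dy/(1-y)`). [cite: Furusho2011, §3] -/
theorem integrable_ly (t : List ℕ) : Integrable (ly t) := by
  suffices h : ∀ (n : ℕ) (t : List ℕ), t.sum + t.length ≤ n → Integrable (ly t) from h _ t le_rfl
  intro n
  induction n with
  | zero =>
    intro t ht
    have : t = [] := by
      cases t with
      | nil => rfl
      | cons a w => simp at ht
    subst this
    rw [ly_nil]; exact integrable_unit
  | succ n ih =>
    intro t ht
    rw [integrable_iff]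
    refine ⟨killsTop_ly t, fun f => ?_⟩
    rcases der_ly_cases f t with h | ⟨t'', h, hlt⟩ <;> rw [h]
    · exact integrable_zero
    · exact ih t'' (by omega)

/-! ### The symmetry `x ↔ y` -/

/-- `topEval ρ (swapL M) = swapL (topEval (ρ ∘ sw) M)`. [folklore] -/
theorem topEval_swapL (ρ : F5 → F5 → ℤ) (M : BarFun) :
    topEval ρ (swapL M) = swapL (topEval (fun x y => ρ (sw x) (sw y)) M) := by
  unfold topEval
  rw [swapL_finset_sum]
  refine (Fintype.sum_equiv (Equiv.ofBijective sw ⟨fun a b h => by simpa using congrArg sw h,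
    fun b => ⟨sw b, sw_sw b⟩⟩) _ _ fun p => ?_)
  rw [swapL_finset_sum]
  refine Fintype.sum_equiv (Equiv.ofBijective sw ⟨fun a b h => by simpa using congrArg sw h,
    fun b => ⟨sw b, sw_sw b⟩⟩) _ _ fun q => ?_
  simp only [Equiv.ofBijective_apply, sw_sw, der_swapL]
  funext w
  simp only [Pi.smul_apply, swapL_apply, smul_eq_mul]

/-- Index permutation of the relations under `x ↔ y`. [folklore] -/
def relSwIdx : Fin 6 → Fin 6 := ![2, 1, 0, 4, 3, 5]

/-- Signs of the relations under `x ↔ y`. [folklore] -/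
def relSwSign : Fin 6 → ℤ := ![-1, -1, -1, 1, 1, -1]

/-- The relation set is symmetric under `x ↔ y` (up to sign and permutation). [folklore] -/
theorem rel_sw (i : Fin 6) : (fun x y => rel i (sw x) (sw y)) = relSwSign i • rel (relSwIdx i) := by
  fin_cases i <;> (funext x y; cases x <;> cases y <;> decide)

/-- `topEval` is `ℤ`-linear in the relation. [folklore] -/
theorem topEval_zsmul (n : ℤ) (ρ : F5 → F5 → ℤ) (M : BarFun) : topEval (n • ρ) M = n • topEval ρ M := by
  unfold topEval
  rw [Finset.smul_sum]
  refine Finset.sum_congr rfl fun p _ => ?_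
  rw [Finset.smul_sum]
  refine Finset.sum_congr rfl fun q _ => ?_
  rw [Pi.smul_apply, Pi.smul_apply, smul_smul, smul_eq_mul]

/-- **Integrability is invariant under `x ↔ y`.** [folklore] -/
theorem Integrable.swapL {L : BarFun} (h : Integrable L) : Integrable (swapL L) := by
  intro u i
  have hsh : shift u (BarFun.swapL L) = BarFun.swapL (shift (u.map sw) L) := by
    funext w; simp [shift, List.map_append]
  rw [hsh, killsTop_iff_topEval, topEval_swapL, rel_sw i, topEval_zsmul]
  have hk : topEval (rel (relSwIdx i)) (shift (u.map sw) L) = 0 := h (u.map sw) (relSwIdx i)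
  rw [hk, smul_zero, swapL_zero]

/-- `l^x_s` is integrable. [cite: Furusho2011, §3] -/
theorem integrable_lx (s : List ℕ) : Integrable (lx s) := by
  rw [← swapL_ly]; exact (integrable_ly s).swapL

/-- `l^{xy}` has no `α₁`- or `β₁`-components, and `∂_{α₀} l^{xy} = ∂_{β₀} l^{xy}`. [folklore] -/
theorem der_lxyD_basic (u : List ℕ) :
    der a1 (lxyD u) = 0 ∧ der b1 (lxyD u) = 0 ∧ der a0 (lxyD u) = der b0 (lxyD u) := by
  rcases u with _ | ⟨_ | _ | e, u'⟩
  · simp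
  · simp
  · simp [der_lxyD_one]
  · simp [der_lxyD_two]

/-- The components of `l^{xy}_u` are `0` or again some `l^{xy}` of smaller size. [folklore] -/
theorem der_lxyD_cases (f : F5) : ∀ u : List ℕ,
    der f (lxyD u) = 0 ∨ ∃ u', der f (lxyD u) = lxyD u' ∧ u'.sum + u'.length < u.sum + u.length
  | [] => Or.inl (by rw [lxyD_nil, der_unit])
  | 0 :: _ => Or.inl (by rw [lxyD_zero, der_zero])
  | 1 :: u' => by
    rw [der_lxyD_one]
    split_ifs
    · exact Or.inr ⟨u', rfl, by simp; omega⟩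
    · exact Or.inl rfl
  | (e + 2) :: u' => by
    rw [der_lxyD_two]
    split_ifs
    · exact Or.inr ⟨(e + 1) :: u', rfl, by simp⟩
    · exact Or.inl rfl

/-- The top conditions for `l^{xy}_u` (`α₀` and `β₀` enter symmetrically, through `dx/x + dy/y`,
and there is no `α₁, β₁`). [folklore] -/
theorem killsTop_lxyD (u : List ℕ) (i : Fin 6) : KillsTop (rel i) (lxyD u) := by
  rw [killsTop_rel_iff]
  obtain ⟨h1, hb1, h00⟩ := der_lxyD_basic u
  -- second components
  have hq : ∀ p, der a1 (der p (lxyD u)) = 0 ∧ der b1 (der p (lxyD u)) = 0 ∧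
      der a0 (der p (lxyD u)) = der b0 (der p (lxyD u)) := fun p => by
    rcases der_lxyD_cases p u with h | ⟨u', h, -⟩ <;> rw [h]
    · simp
    · exact der_lxyD_basic u'
  fin_cases i
  · simp [hb1, (hq a0).2.1]
  · simp [h00, (hq b0).2.2]
  · simp [h1, (hq b0).1]
  · simp [h1, hb1, (hq g).1]
  · simp [h1, hb1, (hq g).2.1]
  · simp [h1, hb1, h00, (hq g).2.2]

/-- **`l^{xy}_u` is integrable**. [cite: Furusho2011, §3] -/
theorem integrable_lxyD (u : List ℕ) : Integrable (lxyD u) := by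
  suffices h : ∀ (n : ℕ) (u : List ℕ), u.sum + u.length ≤ n → Integrable (lxyD u) from h _ u le_rfl
  intro n
  induction n with
  | zero =>
    intro u hu
    have : u = [] := by
      cases u with
      | nil => rfl
      | cons a w => simp at hu
    subst this
    rw [lxyD_nil]; exact integrable_unit
  | succ n ih =>
    intro u hu
    rw [integrable_iff]
    refine ⟨killsTop_lxyD u, fun f => ?_⟩
    rcases der_lxyD_cases f u with h | ⟨u', h, hlt⟩ <;> rw [h]
    · exact integrable_zero
    · exact ih u' (by omega)

/-! ## B.4.3 Integrability of `l^{x,y}` -/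

section Lxy

/-- `[x].dropLast = []`. [folklore] -/
@[simp] theorem dropLast_one (x : ℕ) : [x].dropLast = [] := rfl

/-- `(x y l).dropLast = x (y l).dropLast`. [folklore] -/
@[simp] theorem dropLast_two (x y : ℕ) (l : List ℕ) : (x :: y :: l).dropLast = x :: (y :: l).dropLast := rfl

/-- `(x y l).getLast = (y l).getLast`. [folklore] -/
@[simp] theorem getLast_two (x y : ℕ) (l : List ℕ) (h : x :: y :: l ≠ []) :
    (x :: y :: l).getLast h = (y :: l).getLast (List.cons_ne_nil _ _) := rfl

/-- `l^{xy}` has no `α₁`-component. [folklore] -/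
@[simp] theorem der_a1_lxyD (u : List ℕ) : der a1 (lxyD u) = 0 := (der_lxyD_basic u).1

/-- `l^{xy}` has no `β₁`-component. [folklore] -/
@[simp] theorem der_b1_lxyD (u : List ℕ) : der b1 (lxyD u) = 0 := (der_lxyD_basic u).2.1

/-- `∂_{β₀} l^{xy} = ∂_{α₀} l^{xy}`. [folklore] -/
theorem der_b0_lxyD (u : List ℕ) : der b0 (lxyD u) = der a0 (lxyD u) := (der_lxyD_basic u).2.2.symm

/-- `l_{s, ∅} = l^{xy}_{s}` for every `s` (also `s = ∅`, both being the unit). [folklore] -/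
theorem lxy_nil_right' : ∀ s : List ℕ, lxy s [] = lxyD s
  | [] => by rw [lxy_nil_left, ly_nil, lxyD_nil]
  | c :: s' => lxy_nil_right c s'

variable (c d : ℕ) (s' t'' : List ℕ)

/-- The **corner term** `E`: `l^{xy}_{s'}` when `a_k = b_l = 1` and `𝐛 = (1)`, else `0`; all the
`γ`-second-components of `l^{x,y}_{(c+1)s',(d+1)t''}` are `±E`. [folklore] -/
noncomputable def corner : BarFun := if c = 0 ∧ d = 0 ∧ t'' = [] then lxyD s' else 0

/-- `∂_γ ∂_{β₁} L = E`. [folklore] -/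
theorem der_g_der_b1_lxy (ht : ∀ i ∈ t'', 1 ≤ i) :
    der g (der b1 (lxy ((c + 1) :: s') ((d + 1) :: t''))) = corner c d s' t'' := by
  rcases c with _ | c₀ <;> rcases d with _ | d₀ <;> rcases t'' with _ | ⟨y, t₃⟩
  all_goals first
    | (simp [corner, der_b1_lxy_right_one, der_b1_lxy_right_two, der_lxyD_one, der_lxyD_two]; done)
    | (obtain ⟨y', rfl⟩ : ∃ y', y = y' + 1 := ⟨y - 1, by have := ht y (by simp); omega⟩
       simp [corner, der_b1_lxy_right_one, der_g_lxy_right_succ])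

/-- `∂_γ ∂_{β₀} L = 0`. [folklore] -/
theorem der_g_der_b0_lxy : der g (der b0 (lxy ((c + 1) :: s') ((d + 1) :: t''))) = 0 := by
  rcases d with _ | d₀
  · rw [der_b0_lxy_right_one, der_zero]
  · rw [der_b0_lxy_right_two, der_g_lxy_right_succ]

/-- `∂_γ ∂_{α₀} L = -E`. [folklore] -/
theorem der_g_der_a0_lxy :
    der g (der a0 (lxy ((c + 1) :: s') ((d + 1) :: t''))) = -corner c d s' t'' := by
  rcases c with _ | c₀ <;> rcases d with _ | d₀ <;> rcases t'' with _ | ⟨y, t₃⟩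
  all_goals
    simp [corner, der_a0_lxy_one, der_a0_lxy_two, der_lxyD_one, der_lxyD_two, der_g_lxy_right_succ]

/-- `∂_γ ∂_{α₁} L = -E`. [folklore] -/
theorem der_g_der_a1_lxy :
    der g (der a1 (lxy ((c + 1) :: s') ((d + 1) :: t''))) = -corner c d s' t'' := by
  rcases c with _ | c₀ <;> rcases d with _ | d₀ <;> rcases t'' with _ | ⟨y, t₃⟩
  all_goals
    simp [corner, der_a1_lxy_one, der_a1_lxy_two, der_lxyD_one, der_lxyD_two, der_g_lxy_right_succ]

/-- `∂_{β₁} ∂_{α₁} L - ∂_{α₁} ∂_{β₁} L = E`. [folklore] -/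
theorem der_b1_der_a1_sub_lxy (ht : ∀ i ∈ t'', 1 ≤ i) :
    der b1 (der a1 (lxy ((c + 1) :: s') ((d + 1) :: t''))) -
      der a1 (der b1 (lxy ((c + 1) :: s') ((d + 1) :: t''))) = corner c d s' t'' := by
  rcases c with _ | c₀ <;> rcases d with _ | d₀ <;> rcases t'' with _ | ⟨y, t₃⟩
  all_goals first
    | (simp [corner, der_a1_lxy_one, der_a1_lxy_two, der_b1_lxy_right_one, der_b1_lxy_right_two,
        lxy_nil_right', der_lxyD_one]; done)
    | (obtain ⟨y', rfl⟩ : ∃ y', y = y' + 1 := ⟨y - 1, by have := ht y (by simp); omega⟩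
       simp [corner, der_a1_lxy_one, der_b1_lxy_right_one])

/-- Mixed partials commute: `∂_{β₁} ∂_{α₀} L = ∂_{α₀} ∂_{β₁} L`. [folklore] -/
theorem der_b1_der_a0_lxy (ht : ∀ i ∈ t'', 1 ≤ i) :
    der b1 (der a0 (lxy ((c + 1) :: s') ((d + 1) :: t''))) =
      der a0 (der b1 (lxy ((c + 1) :: s') ((d + 1) :: t''))) := by
  rcases c with _ | c₀ <;> rcases d with _ | d₀ <;> rcases t'' with _ | ⟨y, t₃⟩
  all_goals first
    | (simp [der_a0_lxy_one, der_a0_lxy_two, der_b1_lxy_right_one, der_b1_lxy_right_two,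
        der_lxyD_one, der_lxyD_two]; done)
    | (obtain ⟨y', rfl⟩ : ∃ y', y = y' + 1 := ⟨y - 1, by have := ht y (by simp); omega⟩
       simp [der_a0_lxy_one, der_b1_lxy_right_one])

/-- Mixed partials commute: `∂_{β₀} ∂_{α₀} L = ∂_{α₀} ∂_{β₀} L`. [folklore] -/
theorem der_b0_der_a0_lxy :
    der b0 (der a0 (lxy ((c + 1) :: s') ((d + 1) :: t''))) =
      der a0 (der b0 (lxy ((c + 1) :: s') ((d + 1) :: t''))) := by
  rcases c with _ | c₀ <;> rcases d with _ | d₀ <;> rcases t'' with _ | ⟨y, t₃⟩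
  all_goals
    simp [der_a0_lxy_one, der_a0_lxy_two, der_b0_lxy_right_one, der_b0_lxy_right_two, der_lxyD_one,
      der_lxyD_two]

/-- Mixed partials commute: `∂_{β₀} ∂_{α₁} L = ∂_{α₁} ∂_{β₀} L`. [folklore] -/
theorem der_b0_der_a1_lxy :
    der b0 (der a1 (lxy ((c + 1) :: s') ((d + 1) :: t''))) =
      der a1 (der b0 (lxy ((c + 1) :: s') ((d + 1) :: t''))) := by
  rcases c with _ | c₀ <;> rcases d with _ | d₀ <;> rcases t'' with _ | ⟨y, t₃⟩
  all_goals
    simp [der_a1_lxy_one, der_a1_lxy_two, der_b0_lxy_right_one, der_b0_lxy_right_two, der_lxyD_one,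
      der_lxyD_two]

/-- **The top conditions for `l^{x,y}_{s,t}`** (`s, t ≠ ∅` with positive entries): the six
relations reduce to the commutation of mixed partials and to the corner identities
(`∂_γ∂_{α₁} = ∂_γ∂_{α₀} = -E`, `∂_γ∂_{β₁} = E`, `∂_{β₁}∂_{α₁} - ∂_{α₁}∂_{β₁} = E`). This is the
combinatorial shadow of `d ∘ d Li_{𝐚,𝐛}(x,y) = 0` [Furusho2011, §3]. [cite: Furusho2011, §3] -/
theorem killsTop_lxy (ht : ∀ i ∈ t'', 1 ≤ i) (i : Fin 6) :
    KillsTop (rel i) (lxy ((c + 1) :: s') ((d + 1) :: t'')) := by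
  rw [killsTop_rel_iff]
  have hg : der g (lxy ((c + 1) :: s') ((d + 1) :: t'')) = 0 := der_g_lxy_right_succ d t'' _
  have m1 := der_b1_der_a0_lxy c d s' t'' ht
  have m2 := der_b0_der_a0_lxy c d s' t''
  have m3 := der_b0_der_a1_lxy c d s' t''
  have m4 := der_b1_der_a1_sub_lxy c d s' t'' ht
  have g1 := der_g_der_a1_lxy c d s' t''
  have g2 := der_g_der_b1_lxy c d s' t'' ht
  have g3 := der_g_der_a0_lxy c d s' t''
  have g4 := der_g_der_b0_lxy c d s' t''
  have m4' : der a1 (der b1 (lxy ((c + 1) :: s') ((d + 1) :: t''))) -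
      der b1 (der a1 (lxy ((c + 1) :: s') ((d + 1) :: t''))) = -corner c d s' t'' := by
    rw [← m4]; abel
  fin_cases i
  · rw [m1, sub_self]
  · rw [m2, sub_self]
  · rw [m3, sub_self]
  · rw [g1, hg, der_zero, m4]; abel
  · rw [g2, hg, der_zero, m4']; abel
  · rw [m4, g4, hg, der_zero, g3]; abel

/-- The size measure of a pair of indices. [folklore] -/
abbrev msz (s t : List ℕ) : ℕ := s.sum + s.length + t.sum + t.length

/-- The last element of `(d+1) t''` is positive and all elements of its `dropLast` are, when the
entries of `t''` are. [folklore] -/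
theorem pos_cons_getLast_dropLast {t'' : List ℕ} (ht : ∀ i ∈ t'', 1 ≤ i) (d : ℕ) :
    (1 ≤ ((d + 1) :: t'').getLast (List.cons_ne_nil _ _)) ∧
      ∀ i ∈ ((d + 1) :: t'').dropLast, 1 ≤ i := by
  constructor
  · have hm := List.getLast_mem (List.cons_ne_nil (d + 1) t'')
    rcases List.mem_cons.mp hm with h | h
    · omega
    · exact ht _ h
  · intro i hi
    rcases List.mem_cons.mp (List.mem_of_mem_dropLast hi) with h | h
    · omega
    · exact ht _ h

/-- **`l^{x,y}_{s,t}` is integrable** for all indices with positive entries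
(`l_{∅,t} = l^y_t`, `l_{s,∅} = l^{xy}_s` included): the top conditions by `killsTop_lxy`, the
components by induction on the size. [cite: Furusho2011, §3 (integrability of l^{x,y})] -/
theorem integrable_lxy : ∀ (n : ℕ) (s t : List ℕ), (∀ i ∈ s, 1 ≤ i) → (∀ i ∈ t, 1 ≤ i) →
    msz s t ≤ n → Integrable (lxy s t) := by
  intro n
  induction n with
  | zero =>
    intro s t hs ht hn
    have hs0 : s = [] := by
      cases s with
      | nil => rfl
      | cons a w => simp [msz] at hn
    have ht0 : t = [] := by
      cases t with
      | nil => rfl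
      | cons a w => simp [msz] at hn
    subst hs0; subst ht0
    rw [lxy_nil_left, ly_nil]; exact integrable_unit
  | succ n ih =>
    intro s t hs ht hn
    cases s with
    | nil => rw [lxy_nil_left]; exact integrable_ly t
    | cons c s' =>
      cases t with
      | nil => rw [lxy_nil_right]; exact integrable_lxyD _
      | cons d t'' =>
        obtain ⟨c, rfl⟩ : ∃ c₀, c = c₀ + 1 := ⟨c - 1, by have := hs c (by simp); omega⟩
        obtain ⟨d, rfl⟩ : ∃ d₀, d = d₀ + 1 := ⟨d - 1, by have := ht d (by simp); omega⟩
        have hs' : ∀ i ∈ s', 1 ≤ i := fun i hi => hs i (by simp [hi])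
        have ht'' : ∀ i ∈ t'', 1 ≤ i := fun i hi => ht i (by simp [hi])
        obtain ⟨hb1, ht'⟩ := pos_cons_getLast_dropLast ht'' d
        have hsum := sum_dropLast_add_getLast ((d + 1) :: t'') (List.cons_ne_nil _ _)
        have hlen : ((d + 1) :: t'').dropLast.length + 1 = t''.length + 1 := by
          rw [List.length_dropLast]; simp
        simp only [msz, List.sum_cons, List.length_cons] at hn
        have hbs : ∀ i ∈ ((d + 1) :: t'').getLast (List.cons_ne_nil _ _) :: s', 1 ≤ i := by
          intro i hi
          rcases List.mem_cons.mp hi with h | h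
          · rw [h]; exact hb1
          · exact hs' i h
        have hmb : msz (((d + 1) :: t'').getLast (List.cons_ne_nil _ _) :: s') ((d + 1) :: t'').dropLast ≤ n := by
          simp only [msz, List.sum_cons, List.length_cons] at hsum ⊢
          omega
        rw [integrable_iff]
        refine ⟨killsTop_lxy c d s' t'' ht'', fun f => ?_⟩
        cases f with
        | g => rw [der_g_lxy_right_succ]; exact integrable_zero
        | b0 =>
          rcases d with _ | d₀
          · rw [der_b0_lxy_right_one]; exact integrable_zero
          · rw [der_b0_lxy_right_two]
            refine ih _ _ hs (fun i hi => ?_) ?_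
            · rcases List.mem_cons.mp hi with h | h
              · omega
              · exact ht'' i h
            · simp only [msz, List.sum_cons, List.length_cons]; omega
        | b1 =>
          rcases d with _ | d₀
          · rw [der_b1_lxy_right_one]
            refine ih _ _ hs ht'' ?_
            simp only [msz, List.sum_cons, List.length_cons]; omega
          · rw [der_b1_lxy_right_two]; exact integrable_zero
        | a0 =>
          rcases c with _ | c₀
          · rw [der_a0_lxy_one]
            exact (ih _ _ hbs ht' hmb).neg
          · rw [der_a0_lxy_two]
            refine ih _ _ (fun i hi => ?_) ht ?_
            · rcases List.mem_cons.mp hi with h | h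
              · omega
              · exact hs' i h
            · simp only [msz, List.sum_cons, List.length_cons]; omega
        | a1 =>
          rcases c with _ | c₀
          · rw [der_a1_lxy_one]
            refine (ih _ _ hs' ht ?_).sub (ih _ _ hbs ht' hmb)
            simp only [msz, List.sum_cons, List.length_cons]; omega
          · rw [der_a1_lxy_two]; exact integrable_zero

/-- **`l^{x,y}_{s,t}` and `l^{y,x}_{s,t}` are integrable**, packaged. [cite: Furusho2011, §3] -/
theorem integrable_lxy' {s t : List ℕ} (hs : ∀ i ∈ s, 1 ≤ i) (ht : ∀ i ∈ t, 1 ≤ i) :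
    Integrable (lxy s t) ∧ Integrable (lyx s t) :=
  ⟨integrable_lxy _ s t hs ht le_rfl, (integrable_lxy _ s t hs ht le_rfl).swapL⟩

end Lxy

end BarFun

end Literature.NumberTheory.Transcendental
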